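import Summits.BirchSwinnertonDyer.BirchSwinnertonDyer.Theorems.ByReductionTypeAtTwoSupersingularFlatColemanLinearOfTraces
import Literature.NumberTheory.EllipticCurves.Sprung2017.ChromaticLimit
import Literature.NumberTheory.EllipticCurves.IwasawaAlgebraCyclotomicSeparationProofs
import Literature.NumberTheory.EllipticCurves.PlusMinusPAdicLFunctionProofs
import Literature.NumberTheory.EllipticCurves.PAdicBSDSkinnerUrbanProofs
import HarnessLib

/-!
# Route `ByReductionTypeAtTwo` (rung K4), crux `SupersingularRankZeroAtTwo` (item stmt-BirchSwinnertonDyer-19097), line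
# `odd_blind_package` v2.19, stub 3/5 `stub_flatPackage`, conjunct (8), clause F3 — **FILE Z2 of hand hF3-ZETA: PROPORTIONALITY
# `A' • x = A • x'` IN `𝐇¹` FROM LEVELWISE CONGRUENCES OF THE PAIRING SUMS, BY CHROMATIC CANCELLATION** (cell `bsd-2adic`, seat
# `bsd-2adic-t42` GEN 51; `--supports 19097`, helper)

HONEST FRAMING (D-0054): THEOREMS ONLY — no definition, no named fact, no instance, no `sorry`.  CONSUMER algebra over displayed
hypotheses; `p`-generic (any prime `p ∣ a_p`, any base field, any place, any `(g, c)` with levels and trace relations).  Helper toward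
conjunct (8) F3/ZL2 of `FlatCKPackageAtTwo`; closes NO stub; 19097 stays OPEN on its 5 registered stubs; nothing booked; BSD₂ is proved
for no supersingular curve and BSD for no curve by any of this; typed ≠ proved.

## What and why

Kato's integral classes `y^δ ∈ 𝐇¹` (lifts of `_{c,d}z`) carry CUSP MULTIPLIERS `A_δ ∈ Λ`: the explicit reciprocity computation
(tower-1, hand hF3-ERL, file E3) delivers, for each `δ` and each layer `n`, a congruence «`A_δ·θ̃_n ≡ d·P_{n,c_n}(L y^δ) (mod ω_n)`» in
`Λ ⊗ ℚ_p` with the SAME `θ̃_n` (Mazur–Tate side) for all `δ`.  Two such classes are then PROPORTIONAL: `A_{δ'} • y^δ = A_δ • y^{δ'}`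
in `𝐇¹`.  This file proves that passage in three steps, none of which needs a value computation:
* §1 `Λ`-linearity of the pairing sums modulo `ω_n` THROUGH COLEMAN VALUES: `ω_n ∣ P_{n,c_n}(f • z) − f·P_{n,c_n}(z)` (subtract the Coleman
  congruences of `z` and of `f • z = lambdaSMul f z`, `isColemanPair_lambdaSMul`); and the E3-shape ⇒ difference-congruence adapter
  (`exists_omega_dvd_C_pow_mul_sub_of_thetaCongruences`: two congruences against the same `θ̃` give `ω_n ∣ p^m·(A'·P(z) − A·P(z'))`).
* §2 CHROMATIC CANCELLATION (`smul_coleman_eq_of_levelCongruences`): if `ω_n ∣ p^{m_n}·(A'·P_{n,c_n}(z) − A·P_{n,c_n}(z'))` for every `n`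
  and `(S,F)`, `(S',F')` are Coleman values of `z`, `z'`, then `A'·S = A·S'` and `A'·F = A·F'`: the pair `(A'S − AS', A'F − AF')` is a
  chromatic limit of the ZERO sequence, hence `0` by `Sprung2017.IsChromaticLimit.unique` (needs only `p ∣ a_p`); the `p`-powers are
  removed by `IwasawaAlgebra.coe_dvd_of_coe_dvd_C_pow_mul` (`ω_n` monic).
* §3 ★ `smul_eq_smul_of_levelCongruences`: for ANY `Λ`-module `H`, `Λ`-linear `L : H → H¹_Iw` and `J : H¹_Iw → Λ × Λ` carrying the
  Coleman values, and `J ∘ L` (or just `loc♭ = snd ∘ J ∘ L`) INJECTIVE — file Z1 `pairFun_injective_of_flat_ne_zero` for `H = 𝐇¹ = I.H`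
  of rank `≤ 1` — the levelwise congruences give `A' • x = A • x'` in `H`.

References: [Sprung2012] F. Sprung, J. Number Theory 132 (2012), Def. 3.1 (p. 1489), Prop. 5.7, Def. 5.9 (p. 1495), Def. 7.1 (p. 1500);
[Sprung2017] Thm. 1.12, Cor. 4.4; [Kato2004Asterisque] K. Kato, Astérisque 295 (2004), Thm. 12.5 (1), Thm. 12.6, §13.9, §13.12 (pp. 221–233);
[Washington1997] Lemma 13.7, §7.1.
-/

set_option autoImplicit false
-- the Theorems namespace of this sub repeats the summit name by design (D-0017 nested layout)
set_option linter.dupNamespace false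

noncomputable section

open scoped Classical NumberField

open Polynomial

universe u

namespace Summit.BirchSwinnertonDyer.BirchSwinnertonDyer.Theorems

namespace SSFlatPackage

open Literature.NumberTheory.EllipticCurves Literature.NumberTheory.EllipticCurves.ZpExtension
  Literature.NumberTheory.EllipticCurves.Sprung2017 Literature.NumberTheory.EllipticCurves.Sprung2012
  Literature.NumberTheory.EllipticCurves.Kobayashi2003 Literature.NumberTheory.GaloisRepresentations

section Local

variable {K : Type u} [Field K] {p : ℕ} [hp : Fact p.Prime] {κ : ZpExtension K p}
variable {E : Type u} [Field E] [Algebra K E] {ι : AlgebraicClosure K →ₐ[K] AlgebraicClosure E}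
variable {W : WeierstrassCurve K}

/-! ## §0 `ω_n` bookkeeping -/

/-- `toIwasawa p ω_n` is the coercion of the `ℤ_p`-polynomial `ω_n`. [folklore] -/
theorem toIwasawa_cyclotomicOmega_eq_coe_map (n : ℕ) :
    toIwasawa p (cyclotomicOmega p n) = (((cyclotomicOmega p n).map (Int.castRingHom ℤ_[p]) : ℤ_[p][X]) : PowerSeries ℤ_[p]) :=
  rfl

/-- **`ω_n ∣ p^m·x ⇒ ω_n ∣ x`** in `Λ = ℤ_p⟦T⟧` (`ω_n` is monic, hence relatively prime to `p`; tree
`IwasawaAlgebra.coe_dvd_of_coe_dvd_C_pow_mul`). [cite: Washington1997, Lemma 13.7] -/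
theorem omega_dvd_of_dvd_C_pow_mul {n m : ℕ} {x : IwasawaAlgebra p}
    (h : toIwasawa p (cyclotomicOmega p n) ∣ PowerSeries.C ((p : ℤ_[p]) ^ m) * x) :
    toIwasawa p (cyclotomicOmega p n) ∣ x :=
  IwasawaAlgebra.coe_dvd_of_coe_dvd_C_pow_mul p ((monic_cyclotomicOmega p n).map (Int.castRingHom ℤ_[p])) h

/-! ## §1 `Λ`-linearity of the pairing sums modulo `ω_n`, through Coleman values -/

/-- **Two functionals whose Coleman values differ by the factor `f` have pairing sums differing by `f` modulo `ω_n`**: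
`IsColemanPair z S F` and `IsColemanPair z' (f S) (f F)` give `ω_n ∣ P_{n,c_n}(z') − f·P_{n,c_n}(z)` (subtract the two
congruences). [cite: Sprung2012, Def. 5.9 (p. 1495)] -/
theorem omega_dvd_pairingSum_sub_mul_of_isColemanPair {ap : ℤ} {g : Field.absoluteGaloisGroup E} {c : ℕ → localPoints W E}
    {z z' : localTowerPointsOfEmb κ ι W →+ ℤ_[p]} {S F : IwasawaAlgebra p} (f : IwasawaAlgebra p)
    (hz : IsColemanPair κ ι W ap g c z S F) (hz' : IsColemanPair κ ι W ap g c z' (f * S) (f * F)) (n : ℕ) :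
    toIwasawa p (cyclotomicOmega p n) ∣
      pairingSum W (localTowerPointsOfEmb κ ι W) g n (c n) z' - f * pairingSum W (localTowerPointsOfEmb κ ι W) g n (c n) z := by
  have h1 := hz' n
  have h2 := dvd_mul_of_dvd_right (hz n) f
  have e : pairingSum W (localTowerPointsOfEmb κ ι W) g n (c n) z' - f * pairingSum W (localTowerPointsOfEmb κ ι W) g n (c n) z =
      (pairingSum W (localTowerPointsOfEmb κ ι W) g n (c n) z' +
          (toIwasawa p (sharpPoly ap p n) * (f * S) + toIwasawa p (flatPoly ap p n) * (f * F))) -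
        f * (pairingSum W (localTowerPointsOfEmb κ ι W) g n (c n) z +
          (toIwasawa p (sharpPoly ap p n) * S + toIwasawa p (flatPoly ap p n) * F)) := by ring
  rw [e]
  exact dvd_sub h1 h2

/-- ★ **`P_{n,c_n}(f • z) ≡ f · P_{n,c_n}(z) (mod ω_n)`** for the `Λ`-structure `Sprung2012.moduleOfGenerator κ ι W hg` on the
points-model `H¹_Iw(T)`, from the levels `c_n ∈ E(K_n·K_v)`, the trace relations (`n ≥ 1`) and `p ∣ a_p` alone (so AT `p = 2` for every
datum the registry quantifies over): `z` has a Coleman value (`OddBlindNF.exists_isColemanPair_of_traces`), `f • z` has `f` times it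
(`isColemanPair_lambdaSMul`), subtract. [cite: Sprung2012, Def. 3.1 (p. 1489) and Def. 5.9 (p. 1495)] -/
theorem omega_dvd_pairingSum_smul_sub {g : Field.absoluteGaloisGroup E} (hg : κ.IsTopGenerator (resGalOfEmb ι g))
    {ap : ℤ} (hap : (p : ℤ) ∣ ap) {c : ℕ → localPoints W E} (hcn : ∀ k, c k ∈ localLayerPointsOfEmb κ ι W k)
    (htr : ∀ n, 1 ≤ n → localTraceOfEmb κ ι W n (n + 1) (c (n + 1)) = ap • c n - c (n - 1))
    (f : IwasawaAlgebra p) (z : localTowerPointsOfEmb κ ι W →+ ℤ_[p]) (n : ℕ) :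
    letI := moduleOfGenerator κ ι W hg
    toIwasawa p (cyclotomicOmega p n) ∣
      pairingSum W (localTowerPointsOfEmb κ ι W) g n (c n) (f • z) - f * pairingSum W (localTowerPointsOfEmb κ ι W) g n (c n) z := by
  obtain ⟨S, F, hz⟩ := OddBlindNF.exists_isColemanPair_of_traces hg hap hcn htr z
  rw [moduleOfGenerator_smul_eq]
  exact omega_dvd_pairingSum_sub_mul_of_isColemanPair f hz (isColemanPair_lambdaSMul hg hcn hz f) n

/-- **The E3-shape adapter.**  Two congruences in `Λ ⊗ ℚ_p` against the SAME `Θ ∈ ℚ_p⟦T⟧` — `p^m·(ι A·Θ − ι(C d·P)) = ι(ω_n q)` and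
`p^{m'}·(ι A'·Θ − ι(C d·P')) = ι(ω_n q')` with `d ∈ ℤ_p ∖ 0` — give the INTEGRAL difference congruence `ω_n ∣ p^k·(A'·P − A·P')` for some
`k` (eliminate `Θ`; `ι : Λ ↪ ℚ_p⟦T⟧` injective; `d = unit · p^v`).  This is how tower-1's levelwise output (file E3, shape of
`exists_C_pow_mul_sub_eq_omega_mul_of_forall_eval`) feeds §2. [cite: Pollack2003, Prop. 6.18 (shape of the congruences)]
[cite: Kato2004Asterisque, §13.9 (p. 230)] -/
theorem exists_omega_dvd_C_pow_mul_sub_of_thetaCongruences {n : ℕ} (Θ : PowerSeries ℚ_[p]) {d : ℤ_[p]} (hd : d ≠ 0)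
    {A A' P P' : IwasawaAlgebra p}
    (h : ∃ (m : ℕ) (q : IwasawaAlgebra p), PowerSeries.C ((p : ℚ_[p]) ^ m) *
        (iwasawaToPowerSeries p A * Θ - iwasawaToPowerSeries p (PowerSeries.C d * P)) =
      iwasawaToPowerSeries p ((((cyclotomicOmega p n).map (Int.castRingHom ℤ_[p]) : ℤ_[p][X]) : PowerSeries ℤ_[p]) * q))
    (h' : ∃ (m : ℕ) (q : IwasawaAlgebra p), PowerSeries.C ((p : ℚ_[p]) ^ m) *
        (iwasawaToPowerSeries p A' * Θ - iwasawaToPowerSeries p (PowerSeries.C d * P')) =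
      iwasawaToPowerSeries p ((((cyclotomicOmega p n).map (Int.castRingHom ℤ_[p]) : ℤ_[p][X]) : PowerSeries ℤ_[p]) * q)) :
    ∃ k : ℕ, toIwasawa p (cyclotomicOmega p n) ∣ PowerSeries.C ((p : ℤ_[p]) ^ k) * (A' * P - A * P') := by
  obtain ⟨m, q, e⟩ := h
  obtain ⟨m', q', e'⟩ := h'
  set Ω : IwasawaAlgebra p := (((cyclotomicOmega p n).map (Int.castRingHom ℤ_[p]) : ℤ_[p][X]) : PowerSeries ℤ_[p]) with hΩ
  -- eliminate `Θ`: `p^{m+m'}·d·(A·P' − A'·P) = ω_n·(p^{m'} A' q − p^m A q')` in `Λ`, checked after `ι`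
  have key : iwasawaToPowerSeries p (PowerSeries.C ((p : ℤ_[p]) ^ (m + m')) * (PowerSeries.C d * (A * P' - A' * P))) =
      iwasawaToPowerSeries p (Ω * (PowerSeries.C ((p : ℤ_[p]) ^ m') * A' * q - PowerSeries.C ((p : ℤ_[p]) ^ m) * A * q')) := by
    simp only [map_mul, map_sub, iwasawaToPowerSeries_C_natCast_pow, pow_add]
    simp only [map_mul] at e e'
    linear_combination (iwasawaToPowerSeries p A') * (PowerSeries.C ((p : ℚ_[p]) ^ m')) * e -
      (iwasawaToPowerSeries p A) * (PowerSeries.C ((p : ℚ_[p]) ^ m)) * e'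
  have hΛ := iwasawaToPowerSeries_injective p key
  -- `d = u · p^v` with `u` a unit
  obtain ⟨u, v, hdu⟩ : ∃ (u : ℤ_[p]ˣ) (v : ℕ), d = (u : ℤ_[p]) * (p : ℤ_[p]) ^ v :=
    ⟨_, _, PadicInt.unitCoeff_spec hd⟩
  refine ⟨m + m' + v, ?_⟩
  have hdvd : toIwasawa p (cyclotomicOmega p n) ∣
      PowerSeries.C ((p : ℤ_[p]) ^ (m + m')) * (PowerSeries.C d * (A * P' - A' * P)) := by
    rw [toIwasawa_cyclotomicOmega_eq_coe_map, ← hΩ, hΛ]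
    exact dvd_mul_right Ω _
  rw [hdu] at hdvd
  -- strip the unit and regroup the `p`-powers
  have hu : PowerSeries.C (((u⁻¹ : ℤ_[p]ˣ) : ℤ_[p])) * PowerSeries.C ((u : ℤ_[p]ˣ) : ℤ_[p]) = (1 : IwasawaAlgebra p) := by
    rw [← map_mul, Units.inv_mul, map_one]
  have e2 : PowerSeries.C ((p : ℤ_[p]) ^ (m + m' + v)) * (A' * P - A * P') =
      -(PowerSeries.C (((u⁻¹ : ℤ_[p]ˣ) : ℤ_[p])) : IwasawaAlgebra p) *
        (PowerSeries.C ((p : ℤ_[p]) ^ (m + m')) * (PowerSeries.C ((u : ℤ_[p]) * (p : ℤ_[p]) ^ v) * (A * P' - A' * P))) := by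
    simp only [pow_add, map_mul, map_pow]
    linear_combination (-((PowerSeries.C (p : ℤ_[p]) : IwasawaAlgebra p) ^ m * (PowerSeries.C (p : ℤ_[p])) ^ m' *
      (PowerSeries.C (p : ℤ_[p])) ^ v * (A' * P - A * P'))) * hu
  rw [e2]
  exact Dvd.dvd.mul_left hdvd _

/-! ## §2 Chromatic cancellation -/

/-- The zero pair is a chromatic limit of the zero sequence. [cite: Sprung2017, Cor. 4.4 (shape)] -/
theorem isChromaticLimit_zero (ap : ℤ) : IsChromaticLimit p ap (fun _ ↦ (0 : ℤ_[p][X])) 0 0 :=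
  fun _ ↦ ⟨0, by simp⟩

/-- ★ **CHROMATIC CANCELLATION.**  Let `(S, F)` and `(S', F')` be Coleman values of the functionals `z`, `z'` for the data
`(a_p, g, c)` with `p ∣ a_p`, and let `A, A' ∈ Λ`.  If for every `n` some `p`-power multiple of `A'·P_{n,c_n}(z) − A·P_{n,c_n}(z')` is
divisible by `ω_n`, then `A'·S = A·S'` and `A'·F = A·F'`: the difference pair is a chromatic limit of the zero sequence
(`ω_n ∣ u_n(A'S − AS') + v_n(A'F − AF')`), and chromatic limits are unique (`Sprung2017.IsChromaticLimit.unique`).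
[cite: Sprung2017, Thm. 1.12 (uniqueness) and Cor. 4.4] [cite: Sprung2012, Prop. 5.7 and Def. 5.9 (p. 1495)] -/
theorem smul_coleman_eq_of_levelCongruences {ap : ℤ} (hap : (p : ℤ) ∣ ap) {g : Field.absoluteGaloisGroup E}
    {c : ℕ → localPoints W E} {z z' : localTowerPointsOfEmb κ ι W →+ ℤ_[p]} {S F S' F' : IwasawaAlgebra p}
    (hz : IsColemanPair κ ι W ap g c z S F) (hz' : IsColemanPair κ ι W ap g c z' S' F') (A A' : IwasawaAlgebra p)
    (hlev : ∀ n : ℕ, ∃ m : ℕ, toIwasawa p (cyclotomicOmega p n) ∣ PowerSeries.C ((p : ℤ_[p]) ^ m) *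
      (A' * pairingSum W (localTowerPointsOfEmb κ ι W) g n (c n) z - A * pairingSum W (localTowerPointsOfEmb κ ι W) g n (c n) z')) :
    A' * S = A * S' ∧ A' * F = A * F' := by
  have hlim : IsChromaticLimit p ap (fun _ ↦ (0 : ℤ_[p][X])) (A' * S - A * S') (A' * F - A * F') := by
    intro n
    obtain ⟨m, hm⟩ := hlev n
    have h0 := omega_dvd_of_dvd_C_pow_mul hm
    have h1 := dvd_mul_of_dvd_right (hz n) A'
    have h2 := dvd_mul_of_dvd_right (hz' n) A
    have h3 : toIwasawa p (cyclotomicOmega p n) ∣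
        toIwasawa p (sharpPoly ap p n) * (A' * S - A * S') + toIwasawa p (flatPoly ap p n) * (A' * F - A * F') := by
      have e : toIwasawa p (sharpPoly ap p n) * (A' * S - A * S') + toIwasawa p (flatPoly ap p n) * (A' * F - A * F') =
          A' * (pairingSum W (localTowerPointsOfEmb κ ι W) g n (c n) z +
              (toIwasawa p (sharpPoly ap p n) * S + toIwasawa p (flatPoly ap p n) * F)) -
            A * (pairingSum W (localTowerPointsOfEmb κ ι W) g n (c n) z' +
              (toIwasawa p (sharpPoly ap p n) * S' + toIwasawa p (flatPoly ap p n) * F')) -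
            (A' * pairingSum W (localTowerPointsOfEmb κ ι W) g n (c n) z -
              A * pairingSum W (localTowerPointsOfEmb κ ι W) g n (c n) z') := by ring
      rw [e]
      exact dvd_sub (dvd_sub h1 h2) h0
    obtain ⟨Q, hQ⟩ := h3
    refine ⟨Q, ?_⟩
    rw [Polynomial.coe_zero, zero_add, hQ, toIwasawa_cyclotomicOmega_eq_coe_map]
  obtain ⟨hS, hF⟩ := IsChromaticLimit.unique hap hlim (isChromaticLimit_zero ap)
  exact ⟨sub_eq_zero.mp hS, sub_eq_zero.mp hF⟩

/-! ## §3 Proportionality in `𝐇¹` -/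

/-- ★ **PROPORTIONALITY IN `𝐇¹` (joint form).**  `H` any `Λ`-module (meant: `𝐇¹_Γ(T_pW) = I.H`), `L : H → H¹_Iw(T)` and
`J : H¹_Iw(T) → Λ × Λ` `Λ`-linear with `J w` a Coleman value of `w` for every `w` (p830262 / `OddBlindNF.exists_linearMap_isColemanPair_of_traces`),
and `J ∘ L` INJECTIVE (file Z1).  If for every `n` some `p^m·(A'·P_{n,c_n}(L x) − A·P_{n,c_n}(L x'))` is divisible by `ω_n`, then
`A' • x = A • x'`. [cite: Kato2004Asterisque, §13.9 (p. 230) and Thm. 12.4 (2) (p. 221)] [cite: Sprung2017, Thm. 1.12] -/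
theorem smul_eq_smul_of_levelCongruences {g : Field.absoluteGaloisGroup E} (hg : κ.IsTopGenerator (resGalOfEmb ι g))
    {ap : ℤ} (hap : (p : ℤ) ∣ ap) {c : ℕ → localPoints W E}
    {H : Type*} [AddCommGroup H] [Module (IwasawaAlgebra p) H]
    (L : letI := moduleOfGenerator κ ι W hg; H →ₗ[IwasawaAlgebra p] (localTowerPointsOfEmb κ ι W →+ ℤ_[p]))
    (J : letI := moduleOfGenerator κ ι W hg
      (localTowerPointsOfEmb κ ι W →+ ℤ_[p]) →ₗ[IwasawaAlgebra p] IwasawaAlgebra p × IwasawaAlgebra p)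
    (hJ : ∀ w, IsColemanPair κ ι W ap g c w (J w).1 (J w).2) (hinj : Function.Injective (J ∘ₗ L))
    {x x' : H} {A A' : IwasawaAlgebra p}
    (hlev : ∀ n : ℕ, ∃ m : ℕ, toIwasawa p (cyclotomicOmega p n) ∣ PowerSeries.C ((p : ℤ_[p]) ^ m) *
      (A' * pairingSum W (localTowerPointsOfEmb κ ι W) g n (c n) (L x) -
        A * pairingSum W (localTowerPointsOfEmb κ ι W) g n (c n) (L x'))) :
    A' • x = A • x' := by
  letI := moduleOfGenerator κ ι W hg
  obtain ⟨hS, hF⟩ := smul_coleman_eq_of_levelCongruences hap (hJ (L x)) (hJ (L x')) A A' hlev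
  apply hinj
  change J (L (A' • x)) = J (L (A • x'))
  rw [map_smul, map_smul, map_smul, map_smul]
  exact Prod.ext (by simpa [smul_eq_mul] using hS) (by simpa [smul_eq_mul] using hF)

/-- ★ **PROPORTIONALITY IN `𝐇¹` (♭ form)**: the same with only `loc♭ := snd ∘ J ∘ L` injective (file Z1
`pairFun_injective_of_flat_ne_zero`: automatic on the rank-`≤ 1` module `𝐇¹` once ONE class has a non-zero ♭ Coleman value).
[cite: Kato2004Asterisque, §13.9 (p. 230) and §17.13 (p. 279)] [cite: Sprung2017, Thm. 1.12] -/
theorem smul_eq_smul_of_levelCongruences_flat {g : Field.absoluteGaloisGroup E} (hg : κ.IsTopGenerator (resGalOfEmb ι g))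
    {ap : ℤ} (hap : (p : ℤ) ∣ ap) {c : ℕ → localPoints W E}
    {H : Type*} [AddCommGroup H] [Module (IwasawaAlgebra p) H]
    (L : letI := moduleOfGenerator κ ι W hg; H →ₗ[IwasawaAlgebra p] (localTowerPointsOfEmb κ ι W →+ ℤ_[p]))
    (J : letI := moduleOfGenerator κ ι W hg
      (localTowerPointsOfEmb κ ι W →+ ℤ_[p]) →ₗ[IwasawaAlgebra p] IwasawaAlgebra p × IwasawaAlgebra p)
    (hJ : ∀ w, IsColemanPair κ ι W ap g c w (J w).1 (J w).2)
    (hinj : Function.Injective ((LinearMap.snd (IwasawaAlgebra p) (IwasawaAlgebra p) (IwasawaAlgebra p) ∘ₗ J) ∘ₗ L))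
    {x x' : H} {A A' : IwasawaAlgebra p}
    (hlev : ∀ n : ℕ, ∃ m : ℕ, toIwasawa p (cyclotomicOmega p n) ∣ PowerSeries.C ((p : ℤ_[p]) ^ m) *
      (A' * pairingSum W (localTowerPointsOfEmb κ ι W) g n (c n) (L x) -
        A * pairingSum W (localTowerPointsOfEmb κ ι W) g n (c n) (L x'))) :
    A' • x = A • x' := by
  letI := moduleOfGenerator κ ι W hg
  obtain ⟨-, hF⟩ := smul_coleman_eq_of_levelCongruences hap (hJ (L x)) (hJ (L x')) A A' hlev
  apply hinj
  change (J (L (A' • x))).2 = (J (L (A • x'))).2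
  rw [map_smul, map_smul, map_smul, map_smul]
  simpa [smul_eq_mul] using hF

/-- ★ **PROPORTIONALITY from the E3-shaped congruences** (the form tower-1's hand hF3-ERL delivers): if `x`, `x'` satisfy, at
every layer `n`, `p^m·(ι(A)·Θ_n − ι(C d·P_{n,c_n}(L x))) = ι(ω_n q)` resp. the same with `(A', x')`, for a COMMON `Θ_n ∈ ℚ_p⟦T⟧`
(the Mazur–Tate side) and a common `d ∈ ℤ_p ∖ 0`, and `loc♭` is injective, then `A' • x = A • x'`.
[cite: Kato2004Asterisque, Thm. 12.5 (1) (p. 222), §13.9 (p. 230), §13.12 (pp. 231–233)] [cite: Sprung2017, Thm. 1.12] -/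
theorem smul_eq_smul_of_thetaCongruences {g : Field.absoluteGaloisGroup E} (hg : κ.IsTopGenerator (resGalOfEmb ι g))
    {ap : ℤ} (hap : (p : ℤ) ∣ ap) {c : ℕ → localPoints W E}
    {H : Type*} [AddCommGroup H] [Module (IwasawaAlgebra p) H]
    (L : letI := moduleOfGenerator κ ι W hg; H →ₗ[IwasawaAlgebra p] (localTowerPointsOfEmb κ ι W →+ ℤ_[p]))
    (J : letI := moduleOfGenerator κ ι W hg
      (localTowerPointsOfEmb κ ι W →+ ℤ_[p]) →ₗ[IwasawaAlgebra p] IwasawaAlgebra p × IwasawaAlgebra p)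
    (hJ : ∀ w, IsColemanPair κ ι W ap g c w (J w).1 (J w).2)
    (hinj : Function.Injective ((LinearMap.snd (IwasawaAlgebra p) (IwasawaAlgebra p) (IwasawaAlgebra p) ∘ₗ J) ∘ₗ L))
    (Θ : ℕ → PowerSeries ℚ_[p]) {d : ℤ_[p]} (hd : d ≠ 0) {x x' : H} {A A' : IwasawaAlgebra p}
    (hx : ∀ n : ℕ, ∃ (m : ℕ) (q : IwasawaAlgebra p), PowerSeries.C ((p : ℚ_[p]) ^ m) *
        (iwasawaToPowerSeries p A * Θ n -
          iwasawaToPowerSeries p (PowerSeries.C d * pairingSum W (localTowerPointsOfEmb κ ι W) g n (c n) (L x))) =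
      iwasawaToPowerSeries p ((((cyclotomicOmega p n).map (Int.castRingHom ℤ_[p]) : ℤ_[p][X]) : PowerSeries ℤ_[p]) * q))
    (hx' : ∀ n : ℕ, ∃ (m : ℕ) (q : IwasawaAlgebra p), PowerSeries.C ((p : ℚ_[p]) ^ m) *
        (iwasawaToPowerSeries p A' * Θ n -
          iwasawaToPowerSeries p (PowerSeries.C d * pairingSum W (localTowerPointsOfEmb κ ι W) g n (c n) (L x'))) =
      iwasawaToPowerSeries p ((((cyclotomicOmega p n).map (Int.castRingHom ℤ_[p]) : ℤ_[p][X]) : PowerSeries ℤ_[p]) * q)) :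
    A' • x = A • x' :=
  smul_eq_smul_of_levelCongruences_flat hg hap L J hJ hinj fun n ↦
    exists_omega_dvd_C_pow_mul_sub_of_thetaCongruences (Θ n) hd (hx n) (hx' n)

end Local

end SSFlatPackage

end Summit.BirchSwinnertonDyer.BirchSwinnertonDyer.Theorems

end
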